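import Literature.NumberTheory.Sieve.LargestPrimeFactorCubicS0Expand
import HarnessLib

/-!
# Heath-Brown 2001 (PLMS), §§2, 8: `S₀ = ∑_α w(α)/N(α)` with the signed weight
# `w(α) = ∑_{d∣Q} λ_d #{p ∈ 𝒦 : pd ∣ N(α)}`, and `|w(α)| ≤ τ(N(α))²`

Topic `Literature/NumberTheory/Sieve`; a PROVED structural layer (one definition with body, no named facts)
under the named fact `Irving2015_largestPrimeFactor_cubic` (`LargestPrimeFactorCubic.lean`), continuing
`…S0Expand` (`S₀ = ∑_{d∣Q} λ_d ∑_{p∈𝒦} ∑_{α: pd∣N(α)} 1/N(α)`).  Source: D. R. Heath-Brown, *The largest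
prime factor of `X³ + 2`*, Proc. London Math. Soc. (3) 82 (2001) 554–596, §2 p. 8 (`S₀`) and §8 p. 30:
to pass from `1/N(α)` to `1/N_𝓑` cube by cube ((8.5)–(8.6)) with SIGNED sieve weights one needs the size
of the total weight attached to a generator; we PROVE

* `wgen X v = ∑_{d∣Q} λ_d #{p ∈ 𝒦 : pd ∣ N(v)}` and **`sum_expand_eq_sum_wgen`** —
  `∑_{d∣Q} λ_d ∑_{p∈𝒦} ∑_{v ∈ G, pd ∣ N(v)} φ(v) = ∑_{v∈G} wgen(v) φ(v)` (so `S₀(G) = ∑_v wgen(v)/N(v)`,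
  `S0sumG_eq_sum_wgen`);
* **`abs_wgen_le`** — `|wgen(v)| ≤ τ(N(v))²` for `N(v) ≠ 0` (`|λ_d| ≤ 1`; `d ∣ N(v)` and `p ∣ N(v)`).

## References

* D. R. Heath-Brown, *The largest prime factor of `X³ + 2`*, Proc. London Math. Soc. (3) 82 (2001)
  554–596, §2 p. 8, §8 p. 30. [`HeathBrown2001LargestPrimeFactorCubic`]

## Mathlib / tree search

Tree: `S0sumG_eq_sum`, `sum_pairsG_wt_mul_eq` (`…S0Expand`), `lam`, `abs_lam_le`, `sievePrimes`, `kPrimes`,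
`normNat` (`…Setup`).  Mathlib: `Finset.sum_comm`, `Finset.sum_filter`, `Finset.card_le_card`, `Nat.mem_divisors`.
-/

noncomputable section

open Finset Real

namespace Literature.NumberTheory.Sieve.HeathBrown2001

open LargestPrimeFactorCubic

/-- The signed total weight of a generator: `wgen X v = ∑_{d∣Q} λ_d #{p ∈ 𝒦 : pd ∣ N(v)}`.
[cite: HeathBrown2001LargestPrimeFactorCubic, §2 p. 8] -/
def wgen (X : ℕ) (v : ℕ × ℕ × ℕ) : ℝ :=
  ∑ d ∈ (sievePrimes X).divisors, lam X d * #((kPrimes X).filter fun p => p * d ∣ normNat v)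

/-- **`∑_{d∣Q} λ_d ∑_{p∈𝒦} ∑_{v∈G, pd∣N(v)} φ(v) = ∑_{v∈G} wgen(v) φ(v)`**. [cite: HeathBrown2001LargestPrimeFactorCubic, §8 p. 30] -/
theorem sum_expand_eq_sum_wgen (X : ℕ) (G : Finset (ℕ × ℕ × ℕ)) (φ : (ℕ × ℕ × ℕ) → ℝ) :
    ∑ d ∈ (sievePrimes X).divisors, lam X d *
        ∑ p ∈ kPrimes X, ∑ v ∈ G.filter (fun v => p * d ∣ normNat v), φ v =
      ∑ v ∈ G, wgen X v * φ v := by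
  classical
  -- move the sum over `v` outside
  have h1 : ∀ d ∈ (sievePrimes X).divisors, ∑ p ∈ kPrimes X, ∑ v ∈ G.filter (fun v => p * d ∣ normNat v), φ v =
      ∑ v ∈ G, (#((kPrimes X).filter fun p => p * d ∣ normNat v) : ℝ) * φ v := by
    intro d _
    have : ∀ p ∈ kPrimes X, ∑ v ∈ G.filter (fun v => p * d ∣ normNat v), φ v =
        ∑ v ∈ G, if p * d ∣ normNat v then φ v else 0 := fun p _ => sum_filter _ _
    rw [sum_congr rfl this, sum_comm]
    refine sum_congr rfl fun v _ => ?_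
    rw [← sum_filter, sum_const, nsmul_eq_mul]
  rw [sum_congr rfl fun d hd => by rw [h1 d hd]]
  simp only [mul_sum]
  rw [sum_comm]
  refine sum_congr rfl fun v _ => ?_
  rw [wgen, sum_mul]
  exact sum_congr rfl fun d _ => by ring

/-- Hence `S₀(G) = ∑_{v∈G} wgen(v)/N(v)`. [cite: HeathBrown2001LargestPrimeFactorCubic, §2 p. 8] -/
theorem S0sumG_eq_sum_wgen (X : ℕ) (G : Finset (ℕ × ℕ × ℕ)) :
    S0sumG X G = ∑ v ∈ G, wgen X v * ((1 : ℝ) / normNat v) := by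
  rw [S0sumG_eq_sum, sum_expand_eq_sum_wgen]

/-- **`|wgen(v)| ≤ τ(N(v))²`** when `N(v) ≠ 0`. [folklore] -/
theorem abs_wgen_le (X : ℕ) {v : ℕ × ℕ × ℕ} (hN : normNat v ≠ 0) :
    |wgen X v| ≤ ((#(normNat v).divisors : ℕ) : ℝ) ^ 2 := by
  classical
  set N := normNat v with hNdef
  -- drop the `d ∤ N` (their inner count is `0`), bound `|λ_d| ≤ 1` and each count by `τ(N)`
  have hcount : ∀ d : ℕ, (#((kPrimes X).filter fun p => p * d ∣ N) : ℝ) ≤ #N.divisors := by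
    intro d
    have : ((kPrimes X).filter fun p => p * d ∣ N).image id ⊆ N.divisors := by
      intro p hp
      rw [image_id, mem_filter] at hp
      exact Nat.mem_divisors.mpr ⟨(dvd_mul_right p d).trans hp.2, hN⟩
    rw [image_id] at this
    exact_mod_cast card_le_card this
  have hzero : ∀ d ∈ (sievePrimes X).divisors, ¬ d ∣ N → (#((kPrimes X).filter fun p => p * d ∣ N) : ℝ) = 0 := by
    intro d _ hdN
    rw [Nat.cast_eq_zero, card_eq_zero, filter_eq_empty_iff]
    intro p _ h
    exact hdN ((dvd_mul_left d p).trans h)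
  calc |wgen X v| = |∑ d ∈ (sievePrimes X).divisors.filter (fun d => d ∣ N),
        lam X d * #((kPrimes X).filter fun p => p * d ∣ N)| := by
          rw [wgen, ← hNdef, sum_filter_of_ne]
          intro d hd hne
          by_contra hdN
          rw [hzero d hd hdN, mul_zero] at hne
          exact hne rfl
    _ ≤ ∑ d ∈ (sievePrimes X).divisors.filter (fun d => d ∣ N), |lam X d * #((kPrimes X).filter fun p => p * d ∣ N)| :=
          abs_sum_le_sum_abs _ _
    _ ≤ ∑ _d ∈ (sievePrimes X).divisors.filter (fun d => d ∣ N), (#N.divisors : ℝ) := by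
          refine sum_le_sum fun d _ => ?_
          rw [abs_mul, Nat.abs_cast]
          calc |lam X d| * (#((kPrimes X).filter fun p => p * d ∣ N) : ℝ) ≤ 1 * #N.divisors :=
                mul_le_mul (abs_lam_le X d) (hcount d) (by positivity) zero_le_one
            _ = _ := one_mul _
    _ = #((sievePrimes X).divisors.filter (fun d => d ∣ N)) * (#N.divisors : ℝ) := by rw [sum_const, nsmul_eq_mul]
    _ ≤ #N.divisors * (#N.divisors : ℝ) := by
          gcongr
          intro d hd
          rw [mem_filter] at hd
          exact Nat.mem_divisors.mpr ⟨hd.2, hN⟩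
    _ = ((#N.divisors : ℕ) : ℝ) ^ 2 := by ring

end Literature.NumberTheory.Sieve.HeathBrown2001
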